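import Mathlib
import Summits.NavierStokesRegularity.NavierStokesRegularity.Theses.SymmetryModuliCount
import HarnessLib

/-!
# Route SymmetryModuliCount — the assembly (item stmt-NavierStokesRegularity-4051)

Theorems file closing the assembly item stmt-NavierStokesRegularity-4051
(`Summit.NavierStokesRegularity.NavierStokesRegularity.Theses.SymmetryModuliCount.Assembly`) of route
`SymmetryModuliCount` for `NavierStokesRegularity` (Clay A).

The assembly is PURE LOGIC over the route's items, all taken as hypotheses of the `Assembly` Prop:

* `ForcedSymmetry`-shape: every Type-I KNSS-mild ancient field `u ∈ A_C` is annihilated by a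
  non-trivial similarity generator `ξ = (a, σ, A)` (`A` skew);
* `SymmetricLiouville`-shape: a `u ∈ A_C` annihilated by a non-trivial `ξ` vanishes on `t < 0`;
* `LiouvilleKillsTypeI`: the Liouville statement `X` (every `u ∈ A_C` vanishes) forces every
  finite-energy classical solution from a rapidly decaying datum with Type-I blow-up rate at `T`
  to extend smoothly past `T` (KNSS 2009 §6);
* `NoTypeII`: a maximal smooth Leray–Hopf solution from a rapidly decaying datum blows up at the
  Type-I rate;
* `NoBlowupToClay`: continuation past every `T` of every such classical solution gives Clay (A).

Proof: the first two hypotheses give `X`; `NoBlowupToClay` reduces the summit statement to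
continuation past `T`; if a classical Leray–Hopf solution on `[0, T)` had no smooth extension past
`T` it would be maximal (`IsMaximalSmoothSolution` is by definition `classical ∧ ¬ extension`),
hence Type I by `NoTypeII`, hence extendable by `LiouvilleKillsTypeI` and `X` — contradiction.

References: Koch–Nadirashvili–Seregin–Šverák 2009 (§6, Prop. 6.1); Fefferman 2000 (Clay statement).
No analysis is performed here; every analytic input is an explicit hypothesis of `Assembly`.
-/

-- the summit and its single sub-problem share the name (CONVENTIONS §1), as in every Theorems file
set_option linter.dupNamespace false

namespace Summit.NavierStokesRegularity.NavierStokesRegularity.Theorems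

/-- **Assembly of route `SymmetryModuliCount`** (item stmt-NavierStokesRegularity-4051): the
route's chain `ForcedSymmetry → SymmetricLiouville → LiouvilleKillsTypeI → NoTypeII →
NoBlowupToClay → NavierStokesRegularity` composes by pure logic. The forced non-trivial symmetry
generator of a Type-I mild ancient field, fed to the symmetric Liouville theorem, kills the field
(this is the Liouville statement `X`); a classical Leray–Hopf solution with no smooth extension
past `T` is maximal, hence Type I (`NoTypeII`), hence extends (`LiouvilleKillsTypeI` with `X`) —
contradiction; `NoBlowupToClay` turns continuation past every `T` into Clay (A).
[sources: KNSS2009 §6; Fefferman2000] -/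
theorem symmetryModuliCount_assembly_proof :
    Summit.NavierStokesRegularity.NavierStokesRegularity.Theses.SymmetryModuliCount.Assembly := by
  unfold Summit.NavierStokesRegularity.NavierStokesRegularity.Theses.SymmetryModuliCount.Assembly
  intro hF hS hK hII hClay
  -- Step 1: the Liouville statement `X` from forced symmetry + symmetric Liouville.
  have hX : ∀ (C : ℝ) (u : ℝ → EuclideanSpace ℝ (Fin 3) → EuclideanSpace ℝ (Fin 3)),
      ContDiffOn ℝ (⊤ : ℕ∞) (Function.uncurry u) (Set.Iio 0 ×ˢ Set.univ) ∧
      (∀ t < 0, Literature.Analysis.FluidPDE.VectorCalculus.IsDivFree (u t)) ∧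
      (∀ s t : ℝ, s < t → t < 0 → ∀ x, u t x =
        Literature.Analysis.FluidPDE.heatFlow (u s) (t - s) x -
          ∫ τ in Set.Ioo s t, ∫ y, Literature.Analysis.FluidPDE.oseenKernel (t - τ) (x - y)
            (u τ y) (u τ y)) ∧
      Literature.Analysis.FluidPDE.HasTypeITimeDecay C u → ∀ t < 0, ∀ x, u t x = 0 := by
    intro C u hu
    obtain ⟨a, σ, A, hA, hne, hsym⟩ := hF C u hu
    exact hS C u hu a σ A hA hne hsym
  -- Step 2: Clay (A) from continuation past every `T`; continuation by contradiction.
  apply hClay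
  intro ν T hν hT u p hcl hLH hdec
  by_contra hext
  exact hext (hK hX ν T hν hT u p hcl hLH hdec (hII ν T hν hT u p ⟨hcl, hext⟩ hLH hdec))

end Summit.NavierStokesRegularity.NavierStokesRegularity.Theorems
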